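import Literature.Probability.RandomPlanarGeometry.SAWManhattanLattice
import Literature.Probability.RandomPlanarGeometry.SAWBendingEnergyAllTurnWindow
import Mathlib.NumberTheory.Real.GoldenRatio
import HarnessLib

/-!
# The golden ratio separates the `L` and Manhattan lattices: `μ_L ≤ φ < 81/50 ≤ μ_M`

Topic `Literature/Probability/RandomPlanarGeometry` (continues `SAWManhattanLattice.lean` — `manhattanWalks`,
`manhattanCount`, `logMuM`, the symmetry `manhattanShift`, `manhattanCount_add_le` —, `SAWWords.lean` — step
words, `traj`, `IsSAW` — and `SAWBendingEnergyAllTurnWindow.lean` — `logMuAT`, the all-turn = `L`-lattice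
growth constant, and `logMuAT_le_log_goldenRatio`).

## The statement and the mechanism

Madras–Slade (1993), §1.2: lower bounds on a connective constant come from a SUPERMULTIPLICATIVE sub-family of
walks (there: bridges, (1.2.15)); here the sub-family is a freely concatenable BLOCK LANGUAGE of directed
self-avoiding walks on the Manhattan lattice (streets `x₁ = k` oriented `+x` iff `k` even, avenues `x₀ = k`
oriented `+y` iff `k` odd; Malakis 1975, Kennedy 2018 p. 4). The three blocks, each starting and ending on an even
(east-bound) street, are

* `E` — one step east (length `1`);
* `D` — two steps along the current avenue in its forced direction (length `2`);
* `Z` — the switchback `E E E V W W V E E` (length `9`; `V` = the forced vertical direction of the avenues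
  `x₀ + 1 ≡ x₀ + 3 (mod 2)`, `W` = west along the intermediate odd street).

The number of block words of total length `n` is `g(n)` with `g(n) = g(n−1) + g(n−2) + g(n−9)`
(`manhattanBlockCount`; growth rate `1.6324… > 81/50 = 1.62 > φ`). We prove

* **`manhattanBlockCount_le_manhattanCount` — `g(n) ≤ c^M_n`** (item B1 `ManhattanBlocks` of the lane's
  «φ-SANDWICH» route): instead of decoding block words we run the recursion on WALKS. Let `A_n` be the directed
  `n`-step self-avoiding walks that first descend the avenue `x₀ = 0` (`ω(i) = (0, −i)` for `i ≤ k`) and then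
  stay in the half-plane `x₀ ≥ 1` (`cornered`). Prepending a block `β ∈ {E, D, Z}` to `ω ∈ A_m` — i.e. the walk
  `β` followed by the image of `ω` under the Manhattan symmetry `manhattanShift a_β` that carries the origin to
  the endpoint of `β` (`prep`) — gives three injections `A_{n−1}, A_{n−2}, A_{n−9} → A_n` with pairwise disjoint
  images (the `E`- and `Z`-images separate at time `2` or `6`), whence `#A_n ≥ #A_{n−1} + #A_{n−2} + #A_{n−9}`
  and `g(n) ≤ #A_n ≤ c^M_n` by induction;
* `pow_le_mul_manhattanBlockCount` — `(81/50)^n ≤ 78 g(n)` (item B2, since `κ⁹ ≤ κ⁸ + κ⁷ + 1` at `κ = 81/50`);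
* **`log_le_logMuM` — `log (81/50) ≤ log μ_M`**, i.e. `μ_Manhattan ≥ 1.62` (from B1, B2 and submultiplicativity:
  `(81/50)^{kN} / 78 ≤ c^M_{kN} ≤ (c^M_N)^k`, `k → ∞`);
* **`phiSandwich` — `log μ_L ≤ log φ < log μ_M`** and **`logMuAT_lt_logMuM` — `μ_L < μ_Manhattan`**: the tree's
  `logMuAT_le_log_goldenRatio` (an all-turn word avoids three consecutive equal turns, Fibonacci) and
  `φ = 1.618… < 1.62 = 81/50` (`√5 < 56/25`). The `L` lattice (every vertex a turn) and the Manhattan lattice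
  are the two oriented square lattices of Malakis (1975); their directed self-avoiding walks have DIFFERENT
  connective constants, separated by the golden ratio.

Numerically `μ_M = 1.7335` (Jensen–Guttmann 1998, Table 1); Malakis (1975) prints "rigorous upper and lower
bounds" for `μ_M` (paper not held by the lane; whether its bounds exceed `φ` is not verified here). The point of
the constant `81/50` is the comparison `μ_L ≤ φ < 81/50 ≤ μ_M` with the `L` lattice
(`SAWPlanarConnectiveConstants.lean`).
-/

noncomputable section

open Finset
open Literature.Probability.LatticeModels Literature.Probability.Percolation SimpleGraph

namespace Literature.Probability.RandomPlanarGeometry.SAW.Zd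

/-! ### The block count `g` -/

/-- **The block count** `g(n)`: the number of words over blocks of lengths `1, 2, 9` with total length `n`;
`g(n) = g(n−1) + g(n−2) + g(n−9)` for `n ≥ 9`, Fibonacci below (`g(0..8) = 1, 1, 2, 3, 5, 8, 13, 21, 34`;
structural recursion so that `decide` evaluates it; a-idea-2's `blockCount`, body verbatim).
[cite: MadrasSlade1993, §1.2, eq. (1.2.15)] -/
def manhattanBlockCount : ℕ → ℕ
  | 0 => 1
  | 1 => 1
  | 2 => 2
  | 3 => 3
  | 4 => 5
  | 5 => 8
  | 6 => 13
  | 7 => 21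
  | 8 => 34
  | n + 9 => manhattanBlockCount (n + 8) + manhattanBlockCount (n + 7) + manhattanBlockCount n

/-- The recursion of `g` in the uniform form `g(n+2) = g(n+1) + g(n) + [n ≥ 7] g(n−7)`.
[cite: MadrasSlade1993, §1.2, eq. (1.2.15)] -/
theorem manhattanBlockCount_add_two (n : ℕ) :
    manhattanBlockCount (n + 2) =
      manhattanBlockCount (n + 1) + manhattanBlockCount n + if 7 ≤ n then manhattanBlockCount (n - 7) else 0 := by
  rcases Nat.lt_or_ge n 7 with hn | hn
  · interval_cases n <;> rfl
  · obtain ⟨m, rfl⟩ : ∃ m, n = m + 7 := ⟨n - 7, by omega⟩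
    rw [if_pos (by omega), show m + 7 - 7 = m by omega, show m + 7 + 2 = m + 9 by omega,
      show m + 7 + 1 = m + 8 by omega]
    rfl

/-! ### Manhattan arcs in coordinates -/

/-- A Manhattan arc in coordinates: a horizontal unit step pointing `+x` iff the street index is even, or a
vertical unit step pointing `+y` iff the avenue index is odd. [cite: Kennedy2018ManhattanSLE6, p. 4] -/
theorem isManhattanArc_iff_coord (x y : Site 2) :
    IsManhattanArc x y ↔
      (y 1 = x 1 ∧ (y 0 - x 0 = 1 ∨ y 0 - x 0 = -1) ∧ (y 0 - x 0 = 1 ↔ x 1 % 2 = 0)) ∨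
        (y 0 = x 0 ∧ (y 1 - x 1 = 1 ∨ y 1 - x 1 = -1) ∧ (y 1 - x 1 = 1 ↔ x 0 % 2 = 1)) := by
  unfold IsManhattanArc
  rw [adj_two_iff_coord]
  simp only [Pi.sub_apply, Int.even_iff]
  omega

/-! ### The cornered walks `A_n` -/

/-- `Cornered n ω`: the walk first descends the avenue `x₀ = 0` — `ω(i) = (0, −i)` for `i ≤ k` — and then stays
in the half-plane `x₀ ≥ 1` (times `k < i ≤ n`). [folklore] -/
private def Cornered (n : ℕ) (ω : ℕ → Site 2) : Prop :=
  ∃ k, k ≤ n ∧ (∀ i, i ≤ k → ω i = ![0, -(i : ℤ)]) ∧ ∀ i, k < i → i ≤ n → 1 ≤ ω i 0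

open Classical in
/-- `A_n`: the cornered directed `n`-step self-avoiding walks. [folklore] -/
private def cornered (n : ℕ) : Finset (ℕ → Site 2) := (manhattanWalks n).filter (Cornered n)

/-- Membership in `A_n`. [folklore] -/
private theorem mem_cornered {n : ℕ} {ω : ℕ → Site 2} :
    ω ∈ cornered n ↔ ω ∈ manhattanWalks n ∧ Cornered n ω := by
  classical
  unfold cornered
  rw [Finset.mem_filter]

/-- `#A_n ≤ c^M_n`. [folklore] -/
private theorem card_cornered_le (n : ℕ) : (cornered n).card ≤ manhattanCount n := by
  classical
  unfold cornered manhattanCount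
  exact Finset.card_le_card (Finset.filter_subset _ _)

/-- A cornered walk never enters the half-plane `x₀ < 0`. [folklore] -/
private theorem Cornered.nonneg {n : ℕ} {ω : ℕ → Site 2} (h : Cornered n ω) :
    ∀ i, i ≤ n → 0 ≤ ω i 0 := by
  obtain ⟨k, -, h1, h2⟩ := h
  intro i hi
  rcases le_or_gt i k with hik | hik
  · rw [h1 i hik]; simp
  · exact le_trans zero_le_one (h2 i hik hi)

/-- A cornered walk visits the avenue `x₀ = 0` only during its initial descent. [folklore] -/
private theorem Cornered.eq_of_apply_zero {n : ℕ} {ω : ℕ → Site 2} (h : Cornered n ω) (i : ℕ) (hi : i ≤ n)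
    (h0 : ω i 0 = 0) : ω i = ![0, -(i : ℤ)] := by
  obtain ⟨k, -, h1, h2⟩ := h
  rcases le_or_gt i k with hik | hik
  · exact h1 i hik
  · have := h2 i hik hi; omega

/-- Two sites of `ℤ²` with given coordinates are equal. [folklore] -/
private theorem site_eq {p : Site 2} {a b : ℤ} (h0 : p 0 = a) (h1 : p 1 = b) : p = ![a, b] := by
  funext j; fin_cases j <;> simp [h0, h1]

/-! ### Prepending a block -/

/-- Prepend the block with step word `w` to `ω`, re-rooting `ω` at the endpoint of the block by the Manhattan
symmetry `manhattanShift a` (which carries `0` to `wEnd w` when `wEnd w = manhattanShift a 0`). [folklore] -/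
private def prep (w : List Step) (a : Site 2) (ω : ℕ → Site 2) : ℕ → Site 2 :=
  fun i => if i < w.length then traj w i else manhattanShift a (ω (i - w.length))

/-- `prep` during the block. [folklore] -/
private theorem prep_of_lt {w : List Step} {a : Site 2} {ω : ℕ → Site 2} {i : ℕ} (h : i < w.length) :
    prep w a ω i = traj w i := if_pos h

/-- `prep` after the block. [folklore] -/
private theorem prep_of_le {w : List Step} {a : Site 2} {ω : ℕ → Site 2} {i : ℕ} (h : w.length ≤ i) :
    prep w a ω i = manhattanShift a (ω (i - w.length)) := if_neg (not_lt.2 h)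

/-- `prep` at time `|w| + j` is the re-rooted `ω j`. [folklore] -/
private theorem prep_length_add (w : List Step) (a : Site 2) (ω : ℕ → Site 2) (j : ℕ) :
    prep w a ω (w.length + j) = manhattanShift a (ω j) := by
  rw [prep_of_le (by omega), Nat.add_sub_cancel_left]

/-- Prepending a block is injective (the symmetry is). [folklore] -/
private theorem prep_injective (w : List Step) (a : Site 2) : Function.Injective (prep w a) := by
  intro ω ω' h
  funext j
  have := congrFun h (w.length + j)
  rw [prep_length_add, prep_length_add] at this
  exact manhattanShift_injective a this

/-- **Prepending a block gives a directed self-avoiding walk**, provided the block is a directed self-avoiding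
walk from `0` to `manhattanShift a 0` and misses the re-rooted image of `ω`. [folklore] -/
private theorem prep_mem {w : List Step} {a : Site 2} {n : ℕ} {ω : ℕ → Site 2} (hw : IsSAW w)
    (harcw : ∀ i, i < w.length → IsManhattanArc (traj w i) (traj w (i + 1)))
    (hend : wEnd w = manhattanShift a 0) (hω : ω ∈ manhattanWalks n)
    (hdisj : ∀ i, i < w.length → ∀ j, j ≤ n → traj w i ≠ manhattanShift a (ω j)) {L : ℕ}
    (hL : w.length = L) : prep w a ω ∈ manhattanWalks (n + L) := by
  subst hL
  set L := w.length with hL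
  obtain ⟨hsaw, harc⟩ := mem_manhattanWalks.1 hω
  obtain ⟨h0, hfr, hadj, hinj⟩ := mem_saws.1 hsaw
  obtain ⟨-, -, -, hwinj⟩ := mem_saws.1 (traj_mem_saws rfl hw)
  have hbd : prep w a ω L = traj w L := by
    rw [prep_of_le le_rfl, Nat.sub_self, h0, ← hend, hL, traj_length]
  have hle : ∀ i, i ≤ L → prep w a ω i = traj w i := fun i hi => by
    rcases lt_or_eq_of_le hi with h | h
    · exact prep_of_lt h
    · rw [h]; exact hbd
  refine mem_manhattanWalks.2 ⟨mem_saws.2 ⟨?_, ?_, ?_, ?_⟩, ?_⟩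
  · rw [hle 0 (Nat.zero_le _), traj_zero]
  · intro i hi
    rw [prep_of_le (by omega), prep_of_le (by omega), hfr (i - L) (by omega),
      show n + L - L = n by omega]
  · intro i hi
    rcases lt_or_ge i L with hiL | hiL
    · rw [hle i hiL.le, hle (i + 1) hiL]
      exact adj_traj_succ w hiL
    · rw [prep_of_le hiL, prep_of_le (by omega), show i + 1 - L = (i - L) + 1 by omega]
      exact adj_manhattanShift (hadj (i - L) (by omega))
  · intro i hi j hj hij
    simp only [Set.mem_setOf_eq] at hi hj
    rcases lt_or_ge i L with hiL | hiL <;> rcases lt_or_ge j L with hjL | hjL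
    · rw [hle i hiL.le, hle j hjL.le] at hij
      exact hwinj (by simp only [Set.mem_setOf_eq]; omega) (by simp only [Set.mem_setOf_eq]; omega) hij
    · rw [hle i hiL.le, prep_of_le hjL] at hij
      exact absurd hij (hdisj i hiL (j - L) (by omega))
    · rw [prep_of_le hiL, hle j hjL.le] at hij
      exact absurd hij.symm (hdisj j hjL (i - L) (by omega))
    · rw [prep_of_le hiL, prep_of_le hjL] at hij
      have h1 := manhattanShift_injective a hij
      have h2 := hinj (show i - L ∈ {i | i ≤ n} by simp only [Set.mem_setOf_eq]; omega)
        (show j - L ∈ {i | i ≤ n} by simp only [Set.mem_setOf_eq]; omega) h1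
      omega
  · intro i hi
    rcases lt_or_ge i L with hiL | hiL
    · rw [hle i hiL.le, hle (i + 1) hiL]
      exact harcw i hiL
    · rw [prep_of_le hiL, prep_of_le (by omega), show i + 1 - L = (i - L) + 1 by omega]
      exact isManhattanArc_manhattanShift (harc (i - L) (by omega))

/-! ### The three blocks `E`, `D`, `Z` -/

/-- `E`: one step east. [folklore] -/
private def eWord : List Step := [0]

/-- `D`: two steps south (the forced direction of the avenue `x₀ = 0`). [folklore] -/
private def dWord : List Step := [3, 3]

/-- `Z = E E E N W W N E E`: the switchback through the avenues `x₀ = 3` and `x₀ = 1` (both north-bound). [folklore] -/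
private def zWord : List Step := [0, 0, 0, 1, 2, 2, 1, 0, 0]

/-- Re-rooting after `E`: `(x, y) ↦ (x + 1, −y)`. [folklore] -/
private def aE : Site 2 := ![-1, 0]

/-- Re-rooting after `D`: `(x, y) ↦ (x, y − 2)`. [folklore] -/
private def aD : Site 2 := ![0, 2]

/-- Re-rooting after `Z`: `(x, y) ↦ (x + 3, 2 − y)`. [folklore] -/
private def aZ : Site 2 := ![-3, 2]

/-- The re-rooting map of `E` in coordinates. [folklore] -/
private theorem manhattanShift_aE (p : Site 2) : manhattanShift aE p = ![p 0 + 1, -(p 1)] := by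
  funext j; fin_cases j <;> simp [aE, msign, Int.even_iff]

/-- The re-rooting map of `D` in coordinates. [folklore] -/
private theorem manhattanShift_aD (p : Site 2) : manhattanShift aD p = ![p 0, p 1 - 2] := by
  funext j; fin_cases j <;> simp [aD, msign]

/-- The re-rooting map of `Z` in coordinates. [folklore] -/
private theorem manhattanShift_aZ (p : Site 2) : manhattanShift aZ p = ![p 0 + 3, 2 - p 1] := by
  funext j; fin_cases j <;> simp [aZ, msign, Int.even_iff]

/-- The sites of `E`, by evaluation. [folklore] -/
private theorem eWord_table : traj eWord 0 = ![0, 0] ∧ wEnd eWord = ![1, 0] := by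
  refine ⟨site_eq ?_ ?_, site_eq ?_ ?_⟩ <;> decide

/-- The sites of `D`, by evaluation. [folklore] -/
private theorem dWord_table :
    traj dWord 0 = ![0, 0] ∧ traj dWord 1 = ![0, -1] ∧ wEnd dWord = ![0, -2] := by
  refine ⟨site_eq ?_ ?_, site_eq ?_ ?_, site_eq ?_ ?_⟩ <;> decide

/-- Some sites of `Z`, by evaluation. [folklore] -/
private theorem zWord_table :
    traj zWord 0 = ![0, 0] ∧ traj zWord 1 = ![1, 0] ∧ traj zWord 2 = ![2, 0] ∧ traj zWord 6 = ![1, 1] ∧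
      wEnd zWord = ![3, 2] := by
  refine ⟨site_eq ?_ ?_, site_eq ?_ ?_, site_eq ?_ ?_, site_eq ?_ ?_, site_eq ?_ ?_⟩ <;> decide

/-- The sites of `Z` before its endpoint lie in `0 ≤ x₀ ≤ 3`, on the avenue `x₀ = 0` only at time `0`, and on the
avenue `x₀ = 3` only at heights `≤ 1`. [folklore] -/
private theorem zWord_facts : ∀ i, i < 9 → 0 ≤ traj zWord i 0 ∧ traj zWord i 0 ≤ 3 ∧
    (traj zWord i 0 = 0 → i = 0) ∧ (traj zWord i 0 = 3 → traj zWord i 1 ≤ 1) := by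
  decide

/-- `E` is a directed walk. [folklore] -/
private theorem eWord_arcs : ∀ i, i < eWord.length → IsManhattanArc (traj eWord i) (traj eWord (i + 1)) := by
  simp only [isManhattanArc_iff_coord]; decide

/-- `D` is a directed walk. [folklore] -/
private theorem dWord_arcs : ∀ i, i < dWord.length → IsManhattanArc (traj dWord i) (traj dWord (i + 1)) := by
  simp only [isManhattanArc_iff_coord]; decide

/-- `Z` is a directed walk. [folklore] -/
private theorem zWord_arcs : ∀ i, i < zWord.length → IsManhattanArc (traj zWord i) (traj zWord (i + 1)) := by
  simp only [isManhattanArc_iff_coord]; decide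

/-- `E` is self-avoiding. [folklore] -/
private theorem eWord_saw : IsSAW eWord := by decide
/-- `D` is self-avoiding. [folklore] -/
private theorem dWord_saw : IsSAW dWord := by decide
/-- `Z` is self-avoiding. [folklore] -/
private theorem zWord_saw : IsSAW zWord := by decide

/-! ### The three injections `A_{n} → A_{n+1}`, `A_n → A_{n+2}`, `A_n → A_{n+9}` -/

/-- Prepending `E` to a cornered walk gives a cornered walk. [folklore] -/
private theorem prepE_mem {n : ℕ} {ω : ℕ → Site 2} (hω : ω ∈ cornered n) : prep eWord aE ω ∈ cornered (n + 1) := by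
  obtain ⟨hωM, hC⟩ := mem_cornered.1 hω
  have hnn := hC.nonneg
  refine mem_cornered.2 ⟨?_, 0, by omega, ?_, ?_⟩
  · refine prep_mem eWord_saw eWord_arcs ?_ hωM ?_ (show eWord.length = 1 from rfl)
    · rw [eWord_table.2, manhattanShift_aE]; simp
    · intro i hi j hj
      have hi0 : i = 0 := by simp [eWord] at hi; omega
      subst hi0
      rw [eWord_table.1, manhattanShift_aE]
      intro h
      have := congrFun h 0
      simp at this
      have := hnn j hj
      omega
  · intro i hi
    have hi0 : i = 0 := by omega
    subst hi0
    rw [prep_of_lt (by simp [eWord]), eWord_table.1]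
    simp
  · intro i hi hin
    rw [prep_of_le (by simp [eWord]; omega), manhattanShift_aE]
    simp only [eWord, List.length_singleton, Matrix.cons_val_zero]
    have := hnn (i - 1) (by omega)
    omega

/-- Prepending `D` to a cornered walk gives a cornered walk. [folklore] -/
private theorem prepD_mem {n : ℕ} {ω : ℕ → Site 2} (hω : ω ∈ cornered n) : prep dWord aD ω ∈ cornered (n + 2) := by
  obtain ⟨hωM, hC⟩ := mem_cornered.1 hω
  have hnn := hC.nonneg
  have hz := hC.eq_of_apply_zero
  obtain ⟨k, hk, h1, h2⟩ := hC
  refine mem_cornered.2 ⟨?_, k + 2, by omega, ?_, ?_⟩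
  · refine prep_mem dWord_saw dWord_arcs ?_ hωM ?_ (show dWord.length = 2 from rfl)
    · rw [dWord_table.2.2, manhattanShift_aD]; simp
    · intro i hi j hj h
      have hi2 : i = 0 ∨ i = 1 := by simp [dWord] at hi; omega
      rw [manhattanShift_aD] at h
      have hx := congrFun h 0
      have hy := congrFun h 1
      rcases hi2 with rfl | rfl
      · rw [dWord_table.1] at hx hy
        simp at hx hy
        have := congrFun (hz j hj hx.symm) 1
        simp at this
        omega
      · rw [dWord_table.2.1] at hx hy
        simp at hx hy
        have := congrFun (hz j hj hx.symm) 1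
        simp at this
        omega
  · intro i hi
    rcases Nat.lt_or_ge i 2 with hi2 | hi2
    · rw [prep_of_lt (by simp [dWord]; omega)]
      interval_cases i
      · rw [dWord_table.1]; simp
      · rw [dWord_table.2.1]; simp
    · rw [prep_of_le (by simp [dWord]; omega), manhattanShift_aD]
      simp only [dWord, List.length_cons, List.length_nil]
      rw [h1 (i - 2) (by omega)]
      refine site_eq (by simp) ?_
      simp only [Matrix.cons_val_one, Matrix.cons_val_zero]
      push_cast [Nat.cast_sub hi2]
      ring
  · intro i hi hin
    rw [prep_of_le (by simp [dWord]; omega), manhattanShift_aD]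
    simp only [dWord, List.length_cons, List.length_nil, Matrix.cons_val_zero]
    exact h2 (i - 2) (by omega) (by omega)

/-- Prepending `Z` to a cornered walk gives a cornered walk. [folklore] -/
private theorem prepZ_mem {n : ℕ} {ω : ℕ → Site 2} (hω : ω ∈ cornered n) : prep zWord aZ ω ∈ cornered (n + 9) := by
  obtain ⟨hωM, hC⟩ := mem_cornered.1 hω
  have hnn := hC.nonneg
  have hz := hC.eq_of_apply_zero
  refine mem_cornered.2 ⟨?_, 0, by omega, ?_, ?_⟩
  · refine prep_mem zWord_saw zWord_arcs ?_ hωM ?_ (show zWord.length = 9 from rfl)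
    · rw [zWord_table.2.2.2.2, manhattanShift_aZ]; simp
    · intro i hi j hj h
      have hi9 : i < 9 := by simpa [zWord] using hi
      obtain ⟨-, hle3, h0, h3⟩ := zWord_facts i hi9
      rw [manhattanShift_aZ] at h
      have hx := congrFun h 0
      have hy := congrFun h 1
      simp only [Matrix.cons_val_zero, Matrix.cons_val_one] at hx hy
      have hj0 : ω j 0 = 0 := by have := hnn j hj; omega
      have := congrFun (hz j hj hj0) 1
      simp at this
      have := h3 (by omega)
      omega
  · intro i hi
    have hi0 : i = 0 := by omega
    subst hi0
    rw [prep_of_lt (by simp [zWord]), zWord_table.1]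
    simp
  · intro i hi hin
    rcases Nat.lt_or_ge i 9 with hi9 | hi9
    · rw [prep_of_lt (by simpa [zWord] using hi9)]
      obtain ⟨hge, -, h0, -⟩ := zWord_facts i hi9
      omega
    · rw [prep_of_le (by simpa [zWord] using hi9), manhattanShift_aZ]
      simp only [show zWord.length = 9 from rfl, Matrix.cons_val_zero]
      have := hnn (i - 9) (by omega)
      omega

/-! ### The images are pairwise disjoint -/

/-- The `E`- and `D`-images are disjoint (they differ at time `1`). [folklore] -/
private theorem prepE_ne_prepD {n : ℕ} {ω ω' : ℕ → Site 2} (hω : ω ∈ cornered n) :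
    prep eWord aE ω ≠ prep dWord aD ω' := by
  intro h
  have h0 : ω 0 = 0 := (mem_saws.1 (manhattanWalks_subset_saws n (mem_cornered.1 hω).1)).1
  have := congrFun (congrFun h 1) 0
  rw [prep_of_le (by simp [eWord]), prep_of_lt (by simp [dWord]), manhattanShift_aE, dWord_table.2.1] at this
  simp [eWord, h0] at this

/-- The `D`- and `Z`-images are disjoint (they differ at time `1`). [folklore] -/
private theorem prepD_ne_prepZ {ω ω' : ℕ → Site 2} : prep dWord aD ω ≠ prep zWord aZ ω' := by
  intro h
  have := congrFun (congrFun h 1) 0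
  rw [prep_of_lt (by simp [dWord]), prep_of_lt (by simp [zWord]), dWord_table.2.1, zWord_table.2.1] at this
  simp at this

/-- The `E`-image and the `Z`-image of cornered walks are disjoint: agreement at time `2` forces the `E`-walk's
tail to leave the avenue `x₀ = 0` at once, and then at time `6` its first coordinate is `≥ 2`, while `Z` is
back at `x₀ = 1`. [folklore] -/
private theorem prepE_ne_prepZ {n : ℕ} {ω ω' : ℕ → Site 2} (hω : ω ∈ cornered n) (hn : 5 ≤ n) :
    prep eWord aE ω ≠ prep zWord aZ ω' := by
  intro h
  obtain ⟨-, k, hk, h1, h2⟩ := mem_cornered.1 hω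
  have e2 := congrFun (congrFun h 2) 0
  rw [prep_of_le (by simp [eWord]), prep_of_lt (by simp [zWord]), manhattanShift_aE, zWord_table.2.2.1] at e2
  simp [eWord] at e2
  -- `e2 : ω 1 0 + 1 = 2`
  have hk0 : k = 0 := by
    by_contra hk0
    have := congrFun (h1 1 (by omega)) 0
    simp at this
    omega
  subst hk0
  have e6 := congrFun (congrFun h 6) 0
  rw [prep_of_le (by simp [eWord]), prep_of_lt (by simp [zWord]), manhattanShift_aE, zWord_table.2.2.2.1] at e6
  simp [eWord] at e6
  -- `e6 : ω 5 0 + 1 = 1`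
  have := h2 5 (by omega) (by omega)
  omega

/-! ### The recursion `#A_{n+2} ≥ #A_{n+1} + #A_n + [n ≥ 7] #A_{n−7}` -/

/-- **The recursion**: the three disjoint images give `#A_{n+1} + #A_n + (#A_{n−7} if n ≥ 7) ≤ #A_{n+2}`. [folklore] -/
private theorem card_cornered_rec (n : ℕ) :
    (cornered (n + 1)).card + (cornered n).card + (if 7 ≤ n then (cornered (n - 7)).card else 0) ≤
      (cornered (n + 2)).card := by
  classical
  set SE := (cornered (n + 1)).image (prep eWord aE) with hSE
  set SD := (cornered n).image (prep dWord aD) with hSD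
  set SZ := (if 7 ≤ n then (cornered (n - 7)).image (prep zWord aZ) else ∅) with hSZ
  have hE : SE ⊆ cornered (n + 2) := by
    intro x hx
    obtain ⟨ω, hω, rfl⟩ := Finset.mem_image.1 hx
    exact prepE_mem hω
  have hD : SD ⊆ cornered (n + 2) := by
    intro x hx
    obtain ⟨ω, hω, rfl⟩ := Finset.mem_image.1 hx
    exact prepD_mem hω
  have hZ : SZ ⊆ cornered (n + 2) := by
    intro x hx
    rw [hSZ] at hx
    split_ifs at hx with h7
    · obtain ⟨ω, hω, rfl⟩ := Finset.mem_image.1 hx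
      have := prepZ_mem hω
      rwa [show n - 7 + 9 = n + 2 by omega] at this
    · simp at hx
  have dED : Disjoint SE SD := by
    rw [Finset.disjoint_left]
    intro x hxE hxD
    obtain ⟨ω, hω, rfl⟩ := Finset.mem_image.1 hxE
    obtain ⟨ω', -, h'⟩ := Finset.mem_image.1 hxD
    exact prepE_ne_prepD hω h'.symm
  have dEZ : Disjoint SE SZ := by
    rw [Finset.disjoint_left]
    intro x hxE hxZ
    rw [hSZ] at hxZ
    split_ifs at hxZ with h7
    · obtain ⟨ω, hω, rfl⟩ := Finset.mem_image.1 hxE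
      obtain ⟨ω', -, h'⟩ := Finset.mem_image.1 hxZ
      exact prepE_ne_prepZ hω (by omega) h'.symm
    · simp at hxZ
  have dDZ : Disjoint SD SZ := by
    rw [Finset.disjoint_left]
    intro x hxD hxZ
    rw [hSZ] at hxZ
    split_ifs at hxZ with h7
    · obtain ⟨ω, -, rfl⟩ := Finset.mem_image.1 hxD
      obtain ⟨ω', -, h'⟩ := Finset.mem_image.1 hxZ
      exact prepD_ne_prepZ h'.symm
    · simp at hxZ
  have hcardE : SE.card = (cornered (n + 1)).card := Finset.card_image_of_injective _ (prep_injective _ _)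
  have hcardD : SD.card = (cornered n).card := Finset.card_image_of_injective _ (prep_injective _ _)
  have hcardZ : SZ.card = if 7 ≤ n then (cornered (n - 7)).card else 0 := by
    rw [hSZ]
    split_ifs
    · exact Finset.card_image_of_injective _ (prep_injective _ _)
    · rfl
  have hunion : (SE ∪ SD ∪ SZ) ⊆ cornered (n + 2) :=
    Finset.union_subset (Finset.union_subset hE hD) hZ
  calc (cornered (n + 1)).card + (cornered n).card + (if 7 ≤ n then (cornered (n - 7)).card else 0)
      = SE.card + SD.card + SZ.card := by rw [hcardE, hcardD, hcardZ]
    _ = (SE ∪ SD ∪ SZ).card := by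
        rw [Finset.card_union_of_disjoint (Finset.disjoint_union_left.2 ⟨dEZ, dDZ⟩),
          Finset.card_union_of_disjoint dED]
    _ ≤ (cornered (n + 2)).card := Finset.card_le_card hunion

/-! ### `g(n) ≤ #A_n ≤ c^M_n` -/

/-- The trivial walk is cornered. [folklore] -/
private theorem zero_mem_cornered : (fun _ : ℕ => (0 : Site 2)) ∈ cornered 0 := by
  refine mem_cornered.2 ⟨mem_manhattanWalks.2 ⟨mem_saws.2 ⟨rfl, fun _ _ => rfl, fun i hi => absurd hi (by omega),
    fun i hi j hj _ => ?_⟩, fun j hj => absurd hj (by omega)⟩, 0, le_rfl, fun i hi => ?_, fun i hi hi' => by omega⟩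
  · simp only [Set.mem_setOf_eq] at hi hj; omega
  · have : i = 0 := by omega
    subst this
    exact site_eq rfl (by simp)

/-- `g(n) ≤ #A_n`, by strong induction along the recursion of `g`. [folklore] -/
private theorem manhattanBlockCount_le_card_cornered : ∀ n, manhattanBlockCount n ≤ (cornered n).card := by
  intro n
  induction n using Nat.strong_induction_on with
  | _ n ih =>
    match n, ih with
    | 0, _ => exact Finset.card_pos.2 ⟨_, zero_mem_cornered⟩
    | 1, _ => exact Finset.card_pos.2 ⟨_, prepE_mem zero_mem_cornered⟩
    | n + 2, ih =>
      rw [manhattanBlockCount_add_two]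
      refine le_trans ?_ (card_cornered_rec n)
      have h1 := ih (n + 1) (by omega)
      have h0 := ih n (by omega)
      split_ifs with h7
      · have h7' := ih (n - 7) (by omega)
        omega
      · omega

/-- **`g(n) ≤ c^M_n`** (item B1 `ManhattanBlocks` of the «φ-SANDWICH» route): the Manhattan lattice carries at
least `g(n)` directed `n`-step self-avoiding walks from a site, `g(n) = g(n−1) + g(n−2) + g(n−9)` — the block
language `{E, D, Z}^*` realised through the cornered walks `A_n` and the three prepend injections with disjoint
images. [cite: MadrasSlade1993, §1.2, eq. (1.2.15)] [cite: Malakis1975, abstract] -/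
theorem manhattanBlockCount_le_manhattanCount (n : ℕ) : manhattanBlockCount n ≤ manhattanCount n :=
  (manhattanBlockCount_le_card_cornered n).trans (card_cornered_le n)

/-! ### `(81/50)^n ≤ 78 g(n)` and `μ_M ≥ 81/50` -/

/-- **`(81/50)^n ≤ 78 · g(n)`** (item B2 `BlockCountGrowth`; `κ⁹ ≤ κ⁸ + κ⁷ + 1` at `κ = 81/50`, i.e.
`50/81 + (50/81)² + (50/81)⁹ ≥ 1`; a-idea-2's proof verbatim). [cite: MadrasSlade1993, §1.2, eq. (1.2.15)] -/
theorem pow_le_mul_manhattanBlockCount (n : ℕ) : ((81 : ℝ) / 50) ^ n ≤ 78 * (manhattanBlockCount n : ℝ) := by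
  induction n using Nat.strong_induction_on with
  | _ n ih =>
    rcases Nat.lt_or_ge n 9 with hn | hn
    · interval_cases n <;> norm_num [manhattanBlockCount]
    · obtain ⟨m, rfl⟩ : ∃ m, n = m + 9 := ⟨n - 9, by omega⟩
      rw [show manhattanBlockCount (m + 9) =
          manhattanBlockCount (m + 8) + manhattanBlockCount (m + 7) + manhattanBlockCount m from rfl]
      push_cast
      have h8 := ih (m + 8) (by omega)
      have h7 := ih (m + 7) (by omega)
      have h0 := ih m (by omega)
      have hK : (0 : ℝ) ≤ ((81 : ℝ) / 50) ^ m := by positivity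
      have hnum : ((81 : ℝ) / 50) ^ 9 ≤ ((81 : ℝ) / 50) ^ 8 + ((81 : ℝ) / 50) ^ 7 + 1 := by norm_num
      have e9 : ((81 : ℝ) / 50) ^ (m + 9) = ((81 : ℝ) / 50) ^ m * ((81 : ℝ) / 50) ^ 9 := pow_add _ _ _
      have e8 : ((81 : ℝ) / 50) ^ (m + 8) = ((81 : ℝ) / 50) ^ m * ((81 : ℝ) / 50) ^ 8 := pow_add _ _ _
      have e7 : ((81 : ℝ) / 50) ^ (m + 7) = ((81 : ℝ) / 50) ^ m * ((81 : ℝ) / 50) ^ 7 := pow_add _ _ _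
      rw [e9]; rw [e8] at h8; rw [e7] at h7
      have := mul_le_mul_of_nonneg_left hnum hK
      nlinarith [this, h8, h7, h0]

/-- Iterated submultiplicativity: `c^M_{k m} ≤ (c^M_m)^k`. [cite: MadrasSlade1993, §1.2, eq. (1.2.3)] -/
theorem manhattanCount_mul_le_pow (m : ℕ) : ∀ k : ℕ, manhattanCount (k * m) ≤ manhattanCount m ^ k
  | 0 => by
    have : manhattanCount 0 ≤ 1 := by
      unfold manhattanCount
      refine (Finset.card_le_card (manhattanWalks_subset_saws 0)).trans ?_
      rw [card_saws, count_zero]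
    simpa using this
  | k + 1 => by
    have := manhattanCount_mul_le_pow m k
    calc manhattanCount ((k + 1) * m) = manhattanCount (k * m + m) := by ring_nf
      _ ≤ manhattanCount (k * m) * manhattanCount m := manhattanCount_add_le _ _
      _ ≤ manhattanCount m ^ k * manhattanCount m := Nat.mul_le_mul_right _ this
      _ = manhattanCount m ^ (k + 1) := by ring

/-- `a ≤ b + c/k` for all `k ≥ 1` forces `a ≤ b`. [folklore] -/
private theorem le_of_forall_le_add_div {a b c : ℝ} (h : ∀ k : ℕ, 1 ≤ k → a ≤ b + c / k) : a ≤ b := by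
  by_contra hab
  have hab' : b < a := lt_of_not_ge hab
  obtain ⟨k, hk⟩ := exists_nat_gt (c / (a - b))
  have hpos : 0 < a - b := by linarith
  have hkpos : (0 : ℝ) < (k : ℝ) + 1 := by positivity
  have h1 : c < ((k : ℝ) + 1) * (a - b) := by
    have : c / (a - b) < (k : ℝ) + 1 := by linarith
    rwa [div_lt_iff₀ hpos] at this
  have h2 := h (k + 1) (by omega)
  have h3 : c / ((k + 1 : ℕ) : ℝ) < a - b := by
    push_cast
    rw [div_lt_iff₀ hkpos]
    linarith
  linarith

/-- **`log (81/50) ≤ log μ_M`**, i.e. `μ_Manhattan ≥ 81/50 = 1.62` (target T1 `ManhattanLower` of the «φ-SANDWICH»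
route): from `(81/50)^{kN}/78 ≤ g(kN) ≤ c^M_{kN} ≤ (c^M_N)^k` and `k → ∞` (a-idea-2's `lowerAssembly_holds`).
[cite: MadrasSlade1993, §1.2, eq. (1.2.15) and Lemma 1.2.2] [cite: Malakis1975, abstract] -/
theorem log_le_logMuM : Real.log ((81 : ℝ) / 50) ≤ logMuM := by
  have hB1 := manhattanBlockCount_le_manhattanCount
  have hB2 := pow_le_mul_manhattanBlockCount
  have hcpos : ∀ n, (0 : ℝ) < (manhattanCount n : ℝ) := fun n => by
    exact_mod_cast one_le_manhattanCount n
  show Real.log ((81 : ℝ) / 50) ≤ ⨅ N : ℕ, Real.log (manhattanCount (N + 1)) / ((N : ℝ) + 1)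
  refine le_ciInf fun N => ?_
  have hmpos : (0 : ℝ) < (N : ℝ) + 1 := by positivity
  rw [le_div_iff₀ hmpos]
  have key : ∀ k : ℕ, 1 ≤ k →
      Real.log ((81 : ℝ) / 50) * ((N : ℝ) + 1) ≤ Real.log (manhattanCount (N + 1)) + Real.log 78 / k := by
    intro k hk
    have hkpos : (0 : ℝ) < (k : ℝ) := by exact_mod_cast hk
    have h1 : ((81 : ℝ) / 50) ^ (k * (N + 1)) ≤ 78 * (manhattanCount (N + 1) : ℝ) ^ k := by
      calc ((81 : ℝ) / 50) ^ (k * (N + 1)) ≤ 78 * (manhattanBlockCount (k * (N + 1)) : ℝ) := hB2 _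
        _ ≤ 78 * (manhattanCount (k * (N + 1)) : ℝ) := by
            gcongr; exact_mod_cast hB1 (k * (N + 1))
        _ ≤ 78 * ((manhattanCount (N + 1) ^ k : ℕ) : ℝ) := by
            gcongr; exact_mod_cast manhattanCount_mul_le_pow (N + 1) k
        _ = 78 * (manhattanCount (N + 1) : ℝ) ^ k := by push_cast; ring
    have h2 := Real.log_le_log (by positivity) h1
    rw [Real.log_pow, Real.log_mul (by norm_num) (pow_ne_zero _ (ne_of_gt (hcpos (N + 1)))),
      Real.log_pow] at h2
    push_cast at h2
    have h2' : (k : ℝ) * (Real.log ((81 : ℝ) / 50) * ((N : ℝ) + 1)) ≤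
        (k : ℝ) * (Real.log (manhattanCount (N + 1)) + Real.log 78 / k) := by
      have e : (k : ℝ) * (Real.log (manhattanCount (N + 1)) + Real.log 78 / k) =
          Real.log 78 + k * Real.log (manhattanCount (N + 1)) := by
        field_simp
        ring
      rw [e]
      linarith
    exact le_of_mul_le_mul_left h2' hkpos
  have := le_of_forall_le_add_div key
  linarith

/-! ### The `φ`-sandwich `μ_L ≤ φ < 81/50 ≤ μ_M` -/

/-- `φ < 81/50` (`⟸ √5 < 56/25`; a-idea-2's seam, kernel-checked). [folklore] -/
private theorem goldenRatio_lt : Real.goldenRatio < (81 : ℝ) / 50 := by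
  rw [Real.goldenRatio]
  have h5 : Real.sqrt 5 < (56 : ℝ) / 25 := by
    rw [show ((56 : ℝ) / 25) = Real.sqrt (((56 : ℝ) / 25) ^ 2) by rw [Real.sqrt_sq (by norm_num)]]
    exact Real.sqrt_lt_sqrt (by norm_num) (by norm_num)
  linarith

/-- **«φ-SANDWICH»: `log μ_L ≤ log φ < log μ_M`** — the golden ratio separates the connective constants of the
two oriented square lattices: the `L`-lattice (all-turn) constant `μ_L = exp logMuAT ≤ φ` (no three consecutive
equal turns, tree `logMuAT_le_log_goldenRatio`) and the Manhattan constant `μ_M = exp logMuM ≥ 81/50 > φ`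
(`log_le_logMuM`). (a-idea-2's `PhiSandwich`, body verbatim.) [cite: Malakis1975, abstract]
[cite: MadrasSlade1993, §1.2, eq. (1.2.15)] -/
theorem phiSandwich : Zd.logMuAT ≤ Real.log Real.goldenRatio ∧ Real.log Real.goldenRatio < logMuM := by
  have hφ : Real.log Real.goldenRatio < Real.log ((81 : ℝ) / 50) :=
    Real.log_lt_log Real.goldenRatio_pos goldenRatio_lt
  exact ⟨Zd.logMuAT_le_log_goldenRatio, lt_of_lt_of_le hφ log_le_logMuM⟩

/-- **«L < MANHATTAN»: `μ_L < μ_M`** — directed self-avoiding walks on the Manhattan lattice grow strictly faster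
than on the `L` lattice (`log μ_L ≤ log φ < log (81/50) ≤ log μ_M`; numerically `1.5657 < 1.7335`,
Jensen–Guttmann 1998). (a-idea-2's `LltManhattan`, body verbatim.) [cite: Malakis1975, abstract] -/
theorem logMuAT_lt_logMuM : Zd.logMuAT < logMuM :=
  lt_of_le_of_lt phiSandwich.1 phiSandwich.2

end Literature.Probability.RandomPlanarGeometry.SAW.Zd

end
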